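import Mathlib
import Summits.Langlands.Langlands.Theorems.IwahoriTransientInertia
import Literature.NumberTheory.GaloisRepresentations.GaloisRep
import Literature.NumberTheory.GaloisRepresentations.FrobeniusDensity
import Literature.NumberTheory.GaloisRepresentations.AbsGaloisGroupCompact
import Literature.NumberTheory.GaloisRepresentations.WeilDeligneRepMonodromyProofs
import Literature.NumberTheory.GaloisRepresentations.LocalClassFieldTheoryProofs
import Literature.NumberTheory.GaloisRepresentations.WeilGroupProofs
import Literature.NumberTheory.GaloisRepresentations.GaloisRepUnramifiedProofs
import Literature.NumberTheory.GaloisRepresentations.LAdicCharacterUnramifiedAEProofs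
import Literature.NumberTheory.Automorphic.ChebotarevArtinRepHolds
import Literature.NumberTheory.Automorphic.AdicCompletionLocalField
import Literature.NumberTheory.Automorphic.AdicCompletionResidueCard

/-!
# IwahoriTransient — GLOBAL GALOIS INPUTS of the DAG edge `SemistableShaping ⟸ W⁺ ∧ P(i) ∧ L∤R` (part 1b) — lens-3 gen 26, cell `decomp-langlands`

Three of the five Galois/algebra inputs of the skeleton `SemistableShapingOfAvatars` (HOME/lens-3/g26/dag/), PROVED from the tree:

* §6 `norm_root_charpoly_le_one` (was stub S4) — every root of `charpoly ρ(σ)`, `ρ : Γ_K →ₜ* GL_n(ℚ̄_ℓ)`, has norm `≤ 1`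
  (`Γ_K` compact: `absoluteGaloisGroup_compactSpace`; entries of `ρ(σ^m)` bounded; eigenvector iteration; ultrametric row bound);
* §7 `frobeniusTransfer` (was stub S1) — Frobenius-a.e. coefficientwise closeness of `charpoly ρ`, `charpoly ρ'` ⇒ closeness on ALL of `Γ_K`
  (Frobenius density `absoluteGaloisGroup.frobenius_dense` ⟸ `chebotarev_artinRep_holds`; `Monodromy.continuous_charpoly_coeff`;
  balls are clopen in `ℚ̄_ℓ`);
* §8 `quasiUnipotent_inertia` (was stub S3) — GROTHENDIECK: at `v ∤ ℓ`, every element of a global inertia group `I_𝔓 ≤ Γ_K`, `𝔓 ∣ v`,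
  acts QUASI-UNIPOTENTLY: `∃ k ≠ 0, (ρ(τ)^k − 1)` nilpotent (Grothendieck's local monodromy theorem on the Weil group
  `FramedRep.exists_isOpen_isNilpotent_sub_one_holds` + `I_𝔓 = g · res(I_{K_v}) · g⁻¹` (`exists_absGaloisRestrict_eq_of_mem_inertia`,
  `exists_smul_eq_of_mem_primesAbove_holds`, `WeilGroup.inertia_map_toAbsGalois`) + finite index of an open subgroup of the compact `I_{K_v}`
  (`WeilGroup.isCompact_inertia_holds`) + conjugation invariance of unipotency).
Theorems only; 0 sorry.
-/

set_option linter.dupNamespace false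
set_option linter.unusedVariables false

namespace Summit.Langlands.Langlands.Theorems.IwahoriTransient

open scoped Polynomial Matrix
open Polynomial

/-! ## 6. GALOIS EIGENVALUES ARE INTEGRAL (compactness of `Γ_K`): every root of `charpoly ρ(σ)` has norm `≤ 1`.
Elementary proof: the image `ρ(Γ_K)` is compact, so matrix entries of `ρ(σ^m) = ρ(σ)^m` are bounded uniformly in `m`; an eigenvector
`v` of `ρ(σ)` for `β` gives `‖β‖^m · max|v_i| ≤ B · max|v_i|` (ultrametric row bound), so `‖β‖^m ≤ B` for all `m`, whence `‖β‖ ≤ 1`. -/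
section Integral
open Literature.NumberTheory.GaloisRepresentations

variable {K : Type} [Field K] [NumberField K] {n ℓ : ℕ} [Fact ℓ.Prime]

omit [NumberField K] in
/-- uniform bound on the matrix entries of a continuous representation of the (compact) absolute Galois group. -/
theorem exists_entry_bound (ρ : FramedGaloisRep K (PadicAlgCl ℓ) n) :
    ∃ B : ℝ, 0 ≤ B ∧ ∀ (τ : Field.absoluteGaloisGroup K) (i j : Fin n), ‖((ρ τ : GL (Fin n) (PadicAlgCl ℓ)) : Matrix (Fin n) (Fin n) (PadicAlgCl ℓ)) i j‖ ≤ B := by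
  haveI : CompactSpace (Field.absoluteGaloisGroup K) := absoluteGaloisGroup_compactSpace K
  set F : Field.absoluteGaloisGroup K → ℝ :=
    fun τ => ∑ i, ∑ j, ‖((ρ τ : GL (Fin n) (PadicAlgCl ℓ)) : Matrix (Fin n) (Fin n) (PadicAlgCl ℓ)) i j‖ with hFdef
  have hcont : Continuous fun τ : Field.absoluteGaloisGroup K =>
      ((ρ τ : GL (Fin n) (PadicAlgCl ℓ)) : Matrix (Fin n) (Fin n) (PadicAlgCl ℓ)) :=
    Units.continuous_val.comp (map_continuous ρ)
  have hF : Continuous F := by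
    refine continuous_finsetSum _ fun i _ => continuous_finsetSum _ fun j _ => ?_
    exact (hcont.matrix_elem i j).norm
  obtain ⟨τ₀, -, hτ₀⟩ := isCompact_univ.exists_isMaxOn Set.univ_nonempty hF.continuousOn
  have hF0 : ∀ τ, 0 ≤ F τ := fun τ => Finset.sum_nonneg fun i _ => Finset.sum_nonneg fun j _ => norm_nonneg _
  refine ⟨F τ₀, hF0 τ₀, fun τ i j => ?_⟩
  have h1 : ‖((ρ τ : GL (Fin n) (PadicAlgCl ℓ)) : Matrix (Fin n) (Fin n) (PadicAlgCl ℓ)) i j‖ ≤ F τ := by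
    have hj : ‖((ρ τ : GL (Fin n) (PadicAlgCl ℓ)) : Matrix (Fin n) (Fin n) (PadicAlgCl ℓ)) i j‖
        ≤ ∑ j', ‖((ρ τ : GL (Fin n) (PadicAlgCl ℓ)) : Matrix (Fin n) (Fin n) (PadicAlgCl ℓ)) i j'‖ :=
      Finset.single_le_sum (f := fun j' => ‖((ρ τ : GL (Fin n) (PadicAlgCl ℓ)) : Matrix (Fin n) (Fin n) (PadicAlgCl ℓ)) i j'‖)
        (fun j' _ => norm_nonneg _) (Finset.mem_univ j)
    refine hj.trans ?_
    exact Finset.single_le_sum (f := fun i' => ∑ j', ‖((ρ τ : GL (Fin n) (PadicAlgCl ℓ)) : Matrix (Fin n) (Fin n) (PadicAlgCl ℓ)) i' j'‖)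
      (fun i' _ => Finset.sum_nonneg fun j _ => norm_nonneg _) (Finset.mem_univ i)
  exact h1.trans (hτ₀ (Set.mem_univ τ))

omit [NumberField K] in
/-- S4 PROVED: every root of `charpoly ρ(σ)` (`σ ∈ Γ_K`, `ρ` continuous into `GL_n(ℚ̄_ℓ)`) has norm `≤ 1`. -/
theorem norm_root_charpoly_le_one (ρ : FramedGaloisRep K (PadicAlgCl ℓ) n) (σ : Field.absoluteGaloisGroup K)
    {β : PadicAlgCl ℓ} (hβ : β ∈ (FramedRep.charpoly ρ σ).roots) : ‖β‖ ≤ 1 := by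
  obtain ⟨B, hB0, hB⟩ := exists_entry_bound ρ
  have hroot : ((ρ σ : GL (Fin n) (PadicAlgCl ℓ)) : Matrix (Fin n) (Fin n) (PadicAlgCl ℓ)).charpoly.IsRoot β :=
    (Polynomial.mem_roots (Matrix.charpoly_monic _).ne_zero).mp hβ
  obtain ⟨v, hv, hMv⟩ := exists_eigenvector_of_isRoot_charpoly _ hroot
  obtain ⟨i₁, hi₁⟩ := Function.ne_iff.mp hv
  obtain ⟨i₀, -, hi₀⟩ := Finset.exists_max_image Finset.univ (fun i => ‖v i‖) ⟨i₁, Finset.mem_univ _⟩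
  have hvi₀ : 0 < ‖v i₀‖ := (norm_pos_iff.mpr hi₁).trans_le (hi₀ i₁ (Finset.mem_univ _))
  have hβm : ∀ m : ℕ, ‖β‖ ^ m ≤ B := by
    intro m
    have h1 : (((ρ σ : GL (Fin n) (PadicAlgCl ℓ)) : Matrix (Fin n) (Fin n) (PadicAlgCl ℓ)) ^ m) *ᵥ v = β ^ m • v :=
      pow_mulVec_of_mulVec_eq_smul hMv m
    have h2 : ((ρ σ : GL (Fin n) (PadicAlgCl ℓ)) : Matrix (Fin n) (Fin n) (PadicAlgCl ℓ)) ^ m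
        = ((ρ (σ ^ m) : GL (Fin n) (PadicAlgCl ℓ)) : Matrix (Fin n) (Fin n) (PadicAlgCl ℓ)) := by
      rw [map_pow, Units.val_pow_eq_pow_val]
    have h3 : ‖(β ^ m • v) i₀‖ = ‖β‖ ^ m * ‖v i₀‖ := by
      simp [norm_pow]
    have h4 : ‖((((ρ (σ ^ m) : GL (Fin n) (PadicAlgCl ℓ)) : Matrix (Fin n) (Fin n) (PadicAlgCl ℓ))) *ᵥ v) i₀‖ ≤ B * ‖v i₀‖ := by
      simp only [Matrix.mulVec, dotProduct]
      refine IsUltrametricDist.norm_sum_le_of_forall_le_of_nonneg (by positivity) fun j _ => ?_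
      rw [norm_mul]
      exact mul_le_mul (hB _ _ _) (hi₀ j (Finset.mem_univ _)) (norm_nonneg _) hB0
    have h5 : ‖β‖ ^ m * ‖v i₀‖ ≤ B * ‖v i₀‖ := by
      rw [← h3, ← h1, h2]; exact h4
    exact le_of_mul_le_mul_right h5 hvi₀
  by_contra hgt
  push Not at hgt
  obtain ⟨m, hm⟩ := pow_unbounded_of_one_lt B hgt
  exact absurd (hβm m) (not_le.mpr hm)
end Integral

/-! ## 7. CHEBOTAREV TRANSFER: Frobenius-a.e. closeness of characteristic polynomials ⇒ closeness at EVERY `σ ∈ Γ_K`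
(Frobenius density `absoluteGaloisGroup.frobenius_dense` from `chebotarev_artinRep_holds`; continuity of `charpoly` coefficients;
`{x | v x < r}` is CLOPEN in `ℚ̄_ℓ`). -/
section Transfer
open Literature.NumberTheory.GaloisRepresentations

variable {K : Type} [Field K] [NumberField K] {n ℓ : ℕ} [Fact ℓ.Prime]

/-- S1 PROVED. -/
theorem frobeniusTransfer (ρ ρ' : FramedGaloisRep K (PadicAlgCl ℓ) n) (r : NNReal)
    (hae : ∀ᶠ v : IsDedekindDomain.HeightOneSpectrum (NumberField.RingOfIntegers K) in Filter.cofinite, ∀ 𝔓 ∈ v.primesAbove,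
      ∀ σ : Field.absoluteGaloisGroup K, IsArithFrobAt (NumberField.RingOfIntegers K) σ 𝔓 →
      ∀ i : ℕ, Valued.v ((FramedRep.charpoly ρ σ - FramedRep.charpoly ρ' σ).coeff i) < r)
    (σ : Field.absoluteGaloisGroup K) (i : ℕ) : Valued.v ((FramedRep.charpoly ρ σ - FramedRep.charpoly ρ' σ).coeff i) < r := by
  have hS := Filter.eventually_cofinite.mp hae
  have hD := absoluteGaloisGroup.frobenius_dense Literature.NumberTheory.Automorphic.chebotarev_artinRep_holds K _ hS
  set f : Field.absoluteGaloisGroup K → PadicAlgCl ℓ :=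
    fun τ => (FramedRep.charpoly ρ τ - FramedRep.charpoly ρ' τ).coeff i with hfdef
  have hmat : ∀ ρ₀ : FramedGaloisRep K (PadicAlgCl ℓ) n, Continuous fun τ : Field.absoluteGaloisGroup K =>
      (FramedRep.charpoly ρ₀ τ).coeff i := fun ρ₀ =>
    (Monodromy.continuous_charpoly_coeff i).comp (Units.continuous_val.comp (map_continuous ρ₀))
  have hf : Continuous f := by
    simp only [hfdef, Polynomial.coeff_sub]
    exact (hmat ρ).sub (hmat ρ')
  have hT : IsClosed {τ : Field.absoluteGaloisGroup K | Valued.v (f τ) < r} := by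
    have hset : {τ : Field.absoluteGaloisGroup K | Valued.v (f τ) < r} = f ⁻¹' Metric.ball 0 r := by
      ext τ
      rw [Set.mem_setOf_eq, valued_lt_iff, Set.mem_preimage, mem_ball_zero_iff]
    rw [hset]
    exact (IsUltrametricDist.isClosed_ball 0 (r : ℝ)).preimage hf
  have hsub : {τ : Field.absoluteGaloisGroup K | ∃ v ∉ {w : IsDedekindDomain.HeightOneSpectrum (NumberField.RingOfIntegers K) |
      ¬ ∀ 𝔓 ∈ w.primesAbove, ∀ σ : Field.absoluteGaloisGroup K, IsArithFrobAt (NumberField.RingOfIntegers K) σ 𝔓 →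
        ∀ i : ℕ, Valued.v ((FramedRep.charpoly ρ σ - FramedRep.charpoly ρ' σ).coeff i) < r},
      ∃ 𝔓 ∈ v.primesAbove, IsArithFrobAt (NumberField.RingOfIntegers K) τ 𝔓}
      ⊆ {τ : Field.absoluteGaloisGroup K | Valued.v (f τ) < r} := by
    rintro τ ⟨v, hv, 𝔓, h𝔓, hτ⟩
    simp only [Set.mem_setOf_eq, not_not] at hv
    exact hv 𝔓 h𝔓 τ hτ i
  have hmem : σ ∈ {τ : Field.absoluteGaloisGroup K | Valued.v (f τ) < r} :=
    closure_minimal hsub hT (by rw [hD.closure_eq]; exact Set.mem_univ σ)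
  exact hmem
end Transfer


/-! ## 8. GROTHENDIECK QUASI-UNIPOTENCE OF GLOBAL INERTIA at `v ∤ ℓ` -/
section Monodromy

open Literature Literature.NumberTheory.GaloisRepresentations Literature.NumberTheory.Automorphic
open IsDedekindDomain
open scoped Valued Pointwise

variable {K : Type} [Field K] [NumberField K] {n ℓ : ℕ} [Fact ℓ.Prime]

/-- `ℓ ∤ q_v` at a place `v ∤ ℓ`. -/
theorem not_dvd_residueCard (v : HeightOneSpectrum (NumberField.RingOfIntegers K))
    (hv : ((ℓ : ℕ) : NumberField.RingOfIntegers K) ∉ v.asIdeal) : ¬ ℓ ∣ v.residueCard := by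
  classical
  haveI : Finite (NumberField.RingOfIntegers K ⧸ v.asIdeal) := v.asIdeal.finiteQuotientOfFreeOfNeBot v.ne_bot
  letI : Fintype (NumberField.RingOfIntegers K ⧸ v.asIdeal) := Fintype.ofFinite _
  haveI := v.isMaximal
  letI : Field (NumberField.RingOfIntegers K ⧸ v.asIdeal) := Ideal.Quotient.field v.asIdeal
  obtain ⟨p, hchar', m, hp, hcard⟩ := FiniteField.card' (NumberField.RingOfIntegers K ⧸ v.asIdeal)
  intro hdvd
  rw [HeightOneSpectrum.residueCard_eq_card_quotient, Nat.card_eq_fintype_card, hcard] at hdvd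
  have hℓp : ℓ = p := (Nat.prime_dvd_prime_iff_eq (Fact.out : ℓ.Prime) hp).mp ((Fact.out : ℓ.Prime).dvd_of_dvd_pow hdvd)
  apply hv
  haveI := hchar'
  rw [← Ideal.Quotient.eq_zero_iff_mem, map_natCast, hℓp]
  exact CharP.cast_eq_zero _ p


/-- `(g⁻¹ τ g)^k = g⁻¹ τ^k g`. -/
theorem mul_pow_helper {G : Type*} [Group G] (g τ : G) (k : ℕ) : (g⁻¹ * τ * g) ^ k = g⁻¹ * τ ^ k * g := by
  induction k with
  | zero => simp
  | succ k ih => rw [pow_succ, ih, pow_succ]; group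

/-- S3 PROVED (Grothendieck's monodromy theorem, global eigenvalue-free form): at `v ∤ ℓ` every element of the inertia group of a prime
`𝔓 ∣ v` of `\bar ℤ_K` acts quasi-unipotently in any continuous `ρ : Γ_K →ₜ* GL_n(ℚ̄_ℓ)`. -/
theorem quasiUnipotent_inertia (ρ : FramedGaloisRep K (PadicAlgCl ℓ) n)
    (v : HeightOneSpectrum (NumberField.RingOfIntegers K)) (hv : ((ℓ : ℕ) : NumberField.RingOfIntegers K) ∉ v.asIdeal)
    {𝔓 : Ideal (absIntegers (NumberField.RingOfIntegers K) K)} (h𝔓 : 𝔓 ∈ v.primesAbove)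
    {τ : Field.absoluteGaloisGroup K} (hτ : τ ∈ 𝔓.inertia (Field.absoluteGaloisGroup K)) :
    ∃ k : ℕ, k ≠ 0 ∧ IsNilpotent (((ρ τ : GL (Fin n) (PadicAlgCl ℓ)) : Matrix (Fin n) (Fin n) (PadicAlgCl ℓ)) ^ k - 1) := by
  -- the completion `K_v` and its distinguished prime `𝔓₀ ∣ v`
  have hw := adicCompletion_valuation_le_one_iff K v
  have hO := norm_algebraMap_ringOfIntegers_le_one K v
  have hvlt := norm_algebraMap_ringOfIntegers_lt_one_iff K v
  have hd : DenseRange (algebraMap K (v.adicCompletion K)) :=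
    IsDedekindDomain.HeightOneSpectrum.denseRange_algebraMap (K := K) (v := v)
  obtain ⟨𝔓₀, h𝔓₀⟩ := exists_ideal_forall_mem_iff_spectralNorm_lt_one K (v.adicCompletion K) hO
  have h𝔓₀v : 𝔓₀ ∈ v.primesAbove := mem_primesAbove_of_forall_mem_iff v hvlt 𝔓₀ h𝔓₀
  -- `𝔓 = g • 𝔓₀`, so `g⁻¹ τ g ∈ I_{𝔓₀}`
  obtain ⟨g, rfl⟩ := HeightOneSpectrum.exists_smul_eq_of_mem_primesAbove_holds h𝔓₀v h𝔓
  have hτ₀ : g⁻¹ * τ * g ∈ 𝔓₀.inertia (Field.absoluteGaloisGroup K) := by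
    intro x
    have hx : τ • g • x - g • x ∈ g • 𝔓₀ := hτ (g • x)
    rw [Ideal.mem_pointwise_smul_iff_inv_smul_mem, smul_sub] at hx
    simpa [mul_smul] using hx
  -- `I_{𝔓₀} = res (I_{K_v})`
  obtain ⟨σ, hσI, hσ⟩ := exists_absGaloisRestrict_eq_of_mem_inertia hw hd hO
    (exists_norm_algebraMap_adicCompletion_lt_one K v) 𝔓₀ h𝔓₀ (HeightOneSpectrum.isMaximal_of_mem_primesAbove h𝔓₀v) hτ₀
  -- `‖q_v‖_ℓ = 1`
  have hq : ‖(IsNonarchimedeanLocalField.residueFieldCard (v.adicCompletion K) : PadicAlgCl ℓ)‖ = 1 := by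
    rw [residueFieldCard_adicCompletion_eq]
    exact PadicAlgCl.norm_natCast_eq_one_of_not_dvd (not_dvd_residueCard v hv)
  -- `σ = toAbsGalois u`, `u` in the Weil inertia
  have hσ' : σ ∈ (WeilGroup.inertia (v.adicCompletion K)).map (WeilGroup.toAbsGalois (v.adicCompletion K)) := by
    rw [WeilGroup.inertia_map_toAbsGalois]; exact hσI
  obtain ⟨u, huI, huσ⟩ := Subgroup.mem_map.mp hσ'
  -- Grothendieck's monodromy theorem on `W_{K_v}`
  set ρW : FramedRep (WeilGroup (v.adicCompletion K)) (PadicAlgCl ℓ) n :=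
    (ρ.comp (absGaloisRestrict K (v.adicCompletion K))).comp (WeilGroup.toAbsGaloisContinuous (v.adicCompletion K)) with hρW
  obtain ⟨U, hUI, hUo, hU⟩ :=
    FramedRep.exists_isOpen_isNilpotent_sub_one_holds (F := v.adicCompletion K) (E := PadicAlgCl ℓ) (n := n) hq ρW
  -- `u^k ∈ U` for some `k ≠ 0`: `U ∩ I` is an open subgroup of the compact group `I = I_{K_v}`
  haveI : IsTopologicalGroup (WeilGroup (v.adicCompletion K)) := WeilGroup.isTopologicalGroup_holds (v.adicCompletion K)
  haveI : CompactSpace (WeilGroup.inertia (v.adicCompletion K)) :=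
    isCompact_iff_compactSpace.mp (WeilGroup.isCompact_inertia_holds (v.adicCompletion K))
  set U' : Subgroup (WeilGroup.inertia (v.adicCompletion K)) := U.comap (WeilGroup.inertia (v.adicCompletion K)).subtype with hU'
  have hU'o : IsOpen (U' : Set (WeilGroup.inertia (v.adicCompletion K))) := hUo.preimage continuous_subtype_val
  haveI : Finite ((WeilGroup.inertia (v.adicCompletion K)) ⧸ U') := Subgroup.quotient_finite_of_isOpen U' hU'o
  have hidx : U'.index ≠ 0 := Subgroup.index_ne_zero_of_finite
  obtain ⟨k, hk0, -, hk⟩ := Subgroup.exists_pow_mem_of_index_ne_zero hidx ⟨u, huI⟩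
  have huk : u ^ k ∈ U := by simpa [hU', Subgroup.mem_subgroupOf, Subgroup.mem_comap] using hk
  refine ⟨k, hk0.ne', ?_⟩
  have hnil := hU (u ^ k) huk
  -- transport: `ρW (u^k) = ρ(g)⁻¹ · ρ(τ)^k · ρ(g)`
  have hu1 : ρW u = ρ (g⁻¹ * τ * g) := by
    change ρ (absGaloisRestrict K (v.adicCompletion K) (WeilGroup.toAbsGaloisContinuous (v.adicCompletion K) u)) = _
    rw [WeilGroup.toAbsGaloisContinuous_apply, huσ, hσ]
  have hval : ρW (u ^ k) = (ρ g)⁻¹ * (ρ τ) ^ k * ρ g := by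
    rw [map_pow, hu1, map_mul, map_mul, map_inv, mul_pow_helper]
  rw [hval] at hnil
  have e : ((((ρ g)⁻¹ * (ρ τ) ^ k * ρ g : GL (Fin n) (PadicAlgCl ℓ))) : Matrix (Fin n) (Fin n) (PadicAlgCl ℓ))
      = (((ρ g)⁻¹ : GL (Fin n) (PadicAlgCl ℓ)) : Matrix (Fin n) (Fin n) (PadicAlgCl ℓ))
        * (((ρ τ : GL (Fin n) (PadicAlgCl ℓ)) : Matrix (Fin n) (Fin n) (PadicAlgCl ℓ)) ^ k)
        * ((((ρ g)⁻¹)⁻¹ : GL (Fin n) (PadicAlgCl ℓ)) : Matrix (Fin n) (Fin n) (PadicAlgCl ℓ)) := by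
    rw [inv_inv, Units.val_mul, Units.val_mul, Units.val_pow_eq_pow_val]
  rw [e] at hnil
  -- conjugate back (the top-level form is `GaloisRepresentations.isNilpotent_units_conj_sub_one_iff` of the unbuilt module
  -- `UnipotentInertiaOpenSubgroup`; kept local here to avoid a duplicate declaration)
  have key : ∀ (P : GL (Fin n) (PadicAlgCl ℓ)) (B : Matrix (Fin n) (Fin n) (PadicAlgCl ℓ)),
      IsNilpotent ((P : Matrix (Fin n) (Fin n) (PadicAlgCl ℓ)) * B * ((P⁻¹ : GL (Fin n) (PadicAlgCl ℓ)) : Matrix (Fin n) (Fin n) (PadicAlgCl ℓ)) - 1) →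
        IsNilpotent (B - 1) := by
    rintro P B ⟨m, hm⟩
    refine ⟨m, ?_⟩
    have e1 : (P : Matrix (Fin n) (Fin n) (PadicAlgCl ℓ)) * B * ((P⁻¹ : GL (Fin n) (PadicAlgCl ℓ)) : Matrix (Fin n) (Fin n) (PadicAlgCl ℓ)) - 1
        = (P : Matrix (Fin n) (Fin n) (PadicAlgCl ℓ)) * (B - 1) * ((P⁻¹ : GL (Fin n) (PadicAlgCl ℓ)) : Matrix (Fin n) (Fin n) (PadicAlgCl ℓ)) := by
      rw [mul_sub, sub_mul, mul_one, Units.mul_inv]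
    rw [e1, Units.conj_pow] at hm
    have e2 : (B - 1) ^ m = ((P⁻¹ : GL (Fin n) (PadicAlgCl ℓ)) : Matrix (Fin n) (Fin n) (PadicAlgCl ℓ))
        * ((P : Matrix (Fin n) (Fin n) (PadicAlgCl ℓ)) * (B - 1) ^ m * ((P⁻¹ : GL (Fin n) (PadicAlgCl ℓ)) : Matrix (Fin n) (Fin n) (PadicAlgCl ℓ)))
        * (P : Matrix (Fin n) (Fin n) (PadicAlgCl ℓ)) := by
      rw [← mul_assoc, ← mul_assoc, Units.inv_mul, one_mul, Units.inv_mul_cancel_right]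
    rw [e2, hm, mul_zero, zero_mul]
  exact key _ _ hnil

end Monodromy

end Summit.Langlands.Langlands.Theorems.IwahoriTransient
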